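import Summits.ResolutionOfSingularities.ResolutionOfSingularities.Theorems.MarkedTransferCampaignW31UscOfThm41
import Summits.ResolutionOfSingularities.ResolutionOfSingularities.Theorems.MarkedTransferCampaignW31RegularCut
import Literature.AlgebraicGeometry.Hironaka2017.S16Proof.R097aPage86Claims
import HarnessLib

/-!
# [OURS · L1 W3.1 → GAP-LEDGER R13] The typed semicontinuity sentence `S16Proof.U86_2` (p.86 l.7–8), SINGLE-EXPONENT
# reading, BY NAME from slot W3.1 — and hence modulo the slot's current moduli (`U19_4_R2`; `Thm4_1 ∧ Itm4_1_2_R2`)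

Cell `res-hironaka`, rung L, slot W3.1 aftercare (OURS typer o4). The W3.1 slot statement `CampaignW31UscInvOneExponentI p`
(p463247) was typed «in the shape of `S16Proof.U86_2 S f`» (row 097 part a, p.86 l.7–8: «We know that Inv_η(𝒴′(m−1)) is upper
semi-continuous in Sing(𝒴′(m−1))_cl»; the D-lane binds it BY NAME as `R13:U86_2 SingLast′ InvLast′` in
`S16Proof.Lem16_10_of_usc_named`, p480332). This file records the identification in the kernel so that §M / R13 can cite W3.1 by
name: `CampaignW31.uscOn_iff_U86_2` (`Iff.rfl`), `U86_2_of_uscInvOneExponentI` (every standard `E`, every W3.1 selection: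
`U86_2 (Sing E) (ξ ↦ Inv_ξ(E))`), the `invField` idiom at `Ê = baseHike E` (`U86_2_hat_of_uscInvOneExponentI`, guard `0 < b̂`), the
family form `U86_5` for any family of standard exponents with selections on ONE ambient datum (`U86_5_of_uscInvOneExponentI`),
and the compositions with the slot's moduli of record: `U86_2_of_U19_4_R2` (pv-3/pv-1 chain `…UscModuloHasseStable`),
`U86_2_of_Thm4_1` (pv-1 `…UscOfThm41`, via the discharge lane's `U19_4_R2_of`).

SCOPE (honest). `U86_2` is PARAMETRIC in `(SingLast′, InvLast′)`; the manuscript's instance is the résumé datum of the AR-scheme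
`𝔜′(m−1)` on the blown-up ambient `Z′`. What W3.1 supplies is the instance `(Sing(F), Inv(F))` for ONE standard ideal exponent `F`
on an ambient datum (row 001) with Def. 4.9 edge data — i.e. R13's single-exponent reading (res-adj-3); reading `Inv_η(𝒴′(m−1))`
through one member is GAP-LEDGER R16 (`S16Proof.ResumeWitness.SameInvMembers_ours`, res-type-090 p479091), NOT addressed here,
and `Z′` must itself be presented as an `AmbientDatum` (smooth, irreducible, finite type over the perfect `K`). Pure plumbing over
OURS statements and tree theorems; NOTHING here is a statement of H. Hironaka's manuscript [Hironaka2017] and nothing of it is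
asserted; `U86_2`, `U19_4_R2`, `Thm4_1`, `Itm4_1_2_R2` are typed CANDIDATES consumed as hypotheses or concluded as typed
sentences, never asserted. AI bookkeeping; weaker than expert review.
-/

set_option linter.dupNamespace false -- mandated namespace of this single-conjunct summit

open _root_.AlgebraicGeometry _root_.TopologicalSpace

namespace Summit.ResolutionOfSingularities.ResolutionOfSingularities.Theorems

open Literature.AlgebraicGeometry.Resolution
open Literature.AlgebraicGeometry.Hironaka2017
open Literature.AlgebraicGeometry.Hironaka2017.S02Preliminaries
open Literature.AlgebraicGeometry.Hironaka2017.S04CharAlgebra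
open Literature.AlgebraicGeometry.Hironaka2017.S06BaseHike
open Literature.AlgebraicGeometry.Hironaka2017.Datum

universe u

namespace CampaignW31

/-- Pure logic (`Iff.rfl`): the W3.1 device `CampaignW31.UscOn S f` IS the typed p.86 sentence `S16Proof.U86_2 S f` (same body:
`UpperSemicontinuousOn (fun ξ => (f ξ).key) (S ∩ Z_cl)`). [folklore] -/
theorem uscOn_iff_U86_2 {Z : Scheme.{u}} {n : ℕ} (S : Set Z) (f : Z → EdgeInv n) :
    UscOn S f ↔ S16Proof.U86_2 S f :=
  Iff.rfl

end CampaignW31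

open CampaignW31

/-- **[OURS · L1 W3.1 → R13] `U86_2`, single-exponent reading, FROM THE SLOT STATEMENT**: for every perfect `K` of
characteristic `p`, ambient datum `A`, `n`, STANDARD `E` on `A.Z` and W3.1 selection `sel` of Def. 4.9 edge data on `Sing(E)_cl`,
`S16Proof.U86_2 E.sing (selInv sel)` — i.e. `η ↦ Inv_η(E)` is upper semicontinuous on `Sing(E)_cl`. NOT a statement of the
manuscript (which prints the sentence for the résumé datum `𝒴′(m−1)`, not for one `E`). [folklore] -/
theorem U86_2_of_uscInvOneExponentI (p : ℕ) [Fact p.Prime] (h : CampaignW31UscInvOneExponentI.{u} p)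
    (K : Type u) [Field K] [CharP K p] [PerfectField K] (A : AmbientDatum p K) (n : ℕ)
    (E : IdealExponent A.Z) (hE : E.IsStandard) (sel : EdgeDataSelection p n E CampaignW31.edgeDataProvenance) :
    S16Proof.U86_2 E.sing (selInv sel) :=
  h K A n E hE sel

/-- **The `invField` idiom at `Ê = baseHike E`** (row 010d's carriers, as the D-lane's `U30_2_R2_inst` reads them): for a
standard `E` with `0 < Ê.b` and a CERTIFIED family `ed` of edge data of `Ê` on `Sing(Ê)_cl`, `U86_2 (Sing Ê) (invField Ê ed)` from
the slot statement (selection `EdgeDataSelection.ofFamily`, values identified by `selInv_eq_invField`). [folklore] -/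
theorem U86_2_hat_of_uscInvOneExponentI (p : ℕ) [Fact p.Prime] (h : CampaignW31UscInvOneExponentI.{u} p)
    (K : Type u) [Field K] [CharP K p] [PerfectField K] (A : AmbientDatum p K) (n : ℕ)
    (E : IdealExponent A.Z) (ed : EdgeDataOn p n (baseHike E)) (hE : E.IsStandard) (hb : 0 < (baseHike E).b)
    (hed : IsEdgeDataOn CampaignW31.edgeDataProvenance (baseHike E) ed) :
    S16Proof.U86_2 (baseHike E).sing (invField (baseHike E) ed) := by
  have h' := h K A n (baseHike E) (isStandard_baseHike hE hb) (EdgeDataSelection.ofFamily ed hed)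
  rwa [uscOn_iff_U86_2, selInv_eq_invField, EdgeDataSelection.ofFamily_D] at h'

/-- **Family form `U86_5`** (p.86 l.9–11 «the same is true for every ideal exponent belonging to 𝔜′(m−1)»), for ANY family
`F : M → IdealExponent A.Z` of STANDARD exponents on ONE ambient datum with W3.1 selections: from the slot statement, member by
member. Reading the members of an AR-scheme this way is GAP-LEDGER R16's business, not settled here. [folklore] -/
theorem U86_5_of_uscInvOneExponentI (p : ℕ) [Fact p.Prime] (h : CampaignW31UscInvOneExponentI.{u} p)
    (K : Type u) [Field K] [CharP K p] [PerfectField K] (A : AmbientDatum p K) (n : ℕ) {M : Type u}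
    (F : M → IdealExponent A.Z) (hF : ∀ μ, (F μ).IsStandard)
    (sel : ∀ μ, EdgeDataSelection p n (F μ) CampaignW31.edgeDataProvenance) :
    S16Proof.U86_5 (fun μ => (F μ).sing) (fun μ => selInv (sel μ)) :=
  fun μ => h K A n (F μ) (hF μ) (sel μ)

/-- Conversely (pure logic): the slot statement IS «`U86_2` for every standard `E` and every W3.1 selection». [folklore] -/
theorem campaignW31UscInvOneExponentI_iff_U86_2 (p : ℕ) [Fact p.Prime] :
    CampaignW31UscInvOneExponentI.{u} p ↔
      ∀ (K : Type u) [Field K] [CharP K p] [PerfectField K] (A : AmbientDatum p K) (n : ℕ) (E : IdealExponent A.Z),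
        E.IsStandard → ∀ sel : EdgeDataSelection p n E CampaignW31.edgeDataProvenance, S16Proof.U86_2 E.sing (selInv sel) :=
  Iff.rfl

/-! ## With the slot's moduli of record -/

/-- **[R13 via W3.1] `U86_2` (single-exponent reading) MODULO `U19_4_R2`** (Hasse–Schmidt stability of the edge algebra, §4.1 (8)
reading R2; chain pv-3 `…EdgeHilbDictionary` / `…UscModuloHasseStable` → pv-1 `…UscFiniteDegree` with pv-2's
`CampaignW31EdgeHilbLsc_holds`). [folklore] -/
theorem U86_2_of_U19_4_R2 (p : ℕ) [Fact p.Prime]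
    (hG : ∀ (K : Type u) [Field K] [CharP K p] [PerfectField K] (A : AmbientDatum p K) (E : IdealExponent A.Z),
      U19_4_R2 p A.hom E)
    (K : Type u) [Field K] [CharP K p] [PerfectField K] (A : AmbientDatum p K) (n : ℕ)
    (E : IdealExponent A.Z) (hE : E.IsStandard) (sel : EdgeDataSelection p n E CampaignW31.edgeDataProvenance) :
    S16Proof.U86_2 E.sing (selInv sel) :=
  U86_2_of_uscInvOneExponentI p (campaignW31UscInvOneExponentI_of_U19_4_R2 p hG) K A n E hE sel

/-- **[R13 via W3.1] `U86_2` (single-exponent reading) MODULO `Thm4_1 ∧ Itm4_1_2_R2`** (pv-1 `…UscOfThm41`, through the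
discharge lane's `U19_4_R2_of`, p478118). [folklore] -/
theorem U86_2_of_Thm4_1 (p : ℕ) [Fact p.Prime]
    (h41 : ∀ (K : Type u) [Field K] [CharP K p] [PerfectField K] (A : AmbientDatum p K) (E : IdealExponent A.Z),
      Thm4_1 p A.hom E)
    (h412 : ∀ (K : Type u) [Field K] [CharP K p] [PerfectField K] (A : AmbientDatum p K) (E : IdealExponent A.Z),
      Itm4_1_2_R2 p A.hom E)
    (K : Type u) [Field K] [CharP K p] [PerfectField K] (A : AmbientDatum p K) (n : ℕ)
    (E : IdealExponent A.Z) (hE : E.IsStandard) (sel : EdgeDataSelection p n E CampaignW31.edgeDataProvenance) :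
    S16Proof.U86_2 E.sing (selInv sel) :=
  U86_2_of_uscInvOneExponentI p (campaignW31UscInvOneExponentI_of_Thm4_1 p h41 h412) K A n E hE sel

/-- The `invField` idiom at `Ê`, MODULO `Thm4_1 ∧ Itm4_1_2_R2`. [folklore] -/
theorem U86_2_hat_of_Thm4_1 (p : ℕ) [Fact p.Prime]
    (h41 : ∀ (K : Type u) [Field K] [CharP K p] [PerfectField K] (A : AmbientDatum p K) (E : IdealExponent A.Z),
      Thm4_1 p A.hom E)
    (h412 : ∀ (K : Type u) [Field K] [CharP K p] [PerfectField K] (A : AmbientDatum p K) (E : IdealExponent A.Z),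
      Itm4_1_2_R2 p A.hom E)
    (K : Type u) [Field K] [CharP K p] [PerfectField K] (A : AmbientDatum p K) (n : ℕ)
    (E : IdealExponent A.Z) (ed : EdgeDataOn p n (baseHike E)) (hE : E.IsStandard) (hb : 0 < (baseHike E).b)
    (hed : IsEdgeDataOn CampaignW31.edgeDataProvenance (baseHike E) ed) :
    S16Proof.U86_2 (baseHike E).sing (invField (baseHike E) ed) :=
  U86_2_hat_of_uscInvOneExponentI p (campaignW31UscInvOneExponentI_of_Thm4_1 p h41 h412) K A n E ed hE hb hed

end Summit.ResolutionOfSingularities.ResolutionOfSingularities.Theorems
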